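import Summits.Parity.GeneralizedHardyLittlewood.Theorems.PrimeLevelFamEdgeIdeaDeltasDensityDefs

/-!
# Route `PrimeLevelFamEdge` — TYPED IDEA DELTAS, deck 4′: KERNEL GLUE between the DENSITY doors
# (cell ls-idea; cards K-I3-9 (5) / K-I3-10, lens-3)

PROVED (standard axioms): the SO(even) one-level-density law for `H_k^+(q)` with Fourier support
`v ≥ 1 + 2d₁` implies K-I3-10's signed window-mass door DOOR_W on the window `(d₀, d₁)`, `d₀ > 0`, at
EVERY contraction `θ ≥ 0` — because the SO(even) prediction `soEvenLimit g` of a window profile is `0`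
(the profile vanishes at `0` and on `[−1, 1]`), so `D⁺(g; q) → 0` along the primes. Consequently the
window-mass BRIDGE `WindowMassDoorBridge k A` (K-I3-10: «∃ window, ∃ θ < 1, DOOR_W ⇒ LOneLowerBound A»)
implies the DIRECT door `SOEvenBeyondOneDoor k A` (K-I3-9 (5): «∃ v > 1, SO(even) law ⇒ LOneLowerBound A»):
the window-mass currency is the WEAKER hypothesis family. Pure bookkeeping on the typed predicates of
deck 4 §3–§4; nothing about `L`-functions is proved: «no exceptional-zero theorem (no Landau–Siegel /
Siegel-zero exclusion, no Theorem 1–2 of arXiv:2211.02515, no repaired Margin232) is proved by ideation;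
typed ≠ proved».
-/

noncomputable section

namespace Summit.Parity.GeneralizedHardyLittlewood.Theorems.PrimeLevelFamEdgeIdeaDeltas

open Literature.NumberTheory.LFunctions MeasureTheory Filter

/-- The even harmonic density of the ZERO profile is `0` (every test-function value is `∫ 0 = 0`).
[cite: IwaniecLuoSarnak2000, §1 (1.1)–(1.3)] -/
theorem evenDensity_zero (q : ℕ) [NeZero q] (k : ℤ) :
    OneLevelDensityCusp.evenDensity q k (fun _ : ℝ ↦ (0 : ℂ)) = 0 := by
  have hden : ∀ f : CuspForm (CongruenceSubgroup.Gamma0 q) k,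
      OneLevelDensityCusp.density f (fun _ : ℝ ↦ (0 : ℂ)) (Real.log q) = 0 := by
    intro f
    simp [OneLevelDensityCusp.density, OneLevelDensity.testFn]
  simp [OneLevelDensityCusp.evenDensity, OneLevelDensityCusp.harmonicSumC, hden]

/-- A window profile with `d₀ > −1/2`… we use `d₀ > 0`: it vanishes at `0` and on `[−1, 1]`, so its
(E-I3-1-corrected) SO(even) prediction is `0`. [cite: IwaniecLuoSarnak2000, §1 (1.4)] -/
theorem soEvenLimit_windowProfile {d₀ d₁ : ℝ} (hd₀ : 0 < d₀) {g : ℝ → ℝ}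
    (hg : IsWindowProfile d₀ d₁ g) :
    OneLevelDensityCusp.soEvenLimit (fun u ↦ (g u : ℂ)) = 0 := by
  obtain ⟨_, _, _, hsupp⟩ := hg
  -- g vanishes wherever |u| < 1 + 2d₀, in particular on [-1, 1] and at 0
  have hzero : ∀ u : ℝ, |u| < 1 + 2 * d₀ → g u = 0 := by
    intro u hu
    by_contra hne
    have hmem : u ∈ tsupport g := subset_tsupport g (Function.mem_support.mpr hne)
    have := (hsupp hmem).1
    linarith
  apply soEvenLimit_eq_zero
  · have := hzero 0 (by simp; linarith)
    simp [this]
  · apply setIntegral_eq_zero_of_forall_eq_zero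
    intro u hu
    rw [Set.mem_Icc] at hu
    have : |u| < 1 + 2 * d₀ := by rw [abs_lt]; constructor <;> linarith
    simp [hzero u this]

/-- A window profile (`d₀ > 0`) with vanishing one-sided mass `m(g) = ∫_{u>0} g = 0` is identically `0`
(continuous, non-negative, even, `g 0 = 0`). [folklore] -/
theorem windowProfile_eq_zero_of_windowMass_eq_zero {d₀ d₁ : ℝ} (hd₀ : 0 < d₀) {g : ℝ → ℝ}
    (hg : IsWindowProfile d₀ d₁ g) (hm : windowMass g = 0) : g = 0 := by
  obtain ⟨hsmooth, heven, hnonneg, hsupp⟩ := hg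
  have hcont : Continuous g := hsmooth.continuous
  -- compact support ⇒ integrable
  have hK : HasCompactSupport g := by
    refine IsCompact.of_isClosed_subset (isCompact_Icc : IsCompact (Set.Icc (-(1 + 2 * d₁)) (1 + 2 * d₁)))
      (isClosed_tsupport g) ?_
    intro u hu
    have h := (hsupp hu).2
    rw [Set.mem_Icc]
    rw [abs_le] at h
    exact h
  have hint : Integrable g := hcont.integrable_of_hasCompactSupport hK
  -- g = 0 on (0, ∞): otherwise the window mass would be positive
  have hpos_side : ∀ u : ℝ, 0 < u → g u = 0 := by
    by_contra hex
    push Not at hex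
    obtain ⟨u₀, hu₀, hgu₀⟩ := hex
    have hopen : IsOpen (Function.support g ∩ Set.Ioi 0) :=
      (isOpen_compl_singleton.preimage hcont).inter isOpen_Ioi
    have hne : (Function.support g ∩ Set.Ioi 0).Nonempty := ⟨u₀, Function.mem_support.mpr hgu₀, hu₀⟩
    have hμ : 0 < volume (Function.support g ∩ Set.Ioi 0) := hopen.measure_pos volume hne
    have hposint : 0 < ∫ u in Set.Ioi (0 : ℝ), g u := by
      rw [setIntegral_pos_iff_support_of_nonneg_ae]
      · exact hμ
      · exact Eventually.of_forall fun u ↦ hnonneg u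
      · exact hint.integrableOn
    have : windowMass g = ∫ u in Set.Ioi (0 : ℝ), g u := rfl
    linarith
  have h0 : g 0 = 0 := by
    by_contra hne
    have hmem : (0 : ℝ) ∈ tsupport g := subset_tsupport g (Function.mem_support.mpr hne)
    have := (hsupp hmem).1
    simp at this
    linarith
  funext u
  rcases lt_trichotomy u 0 with hu | hu | hu
  · have := hpos_side (-u) (by linarith)
    rw [heven] at this
    exact this
  · subst hu; exact h0
  · exact hpos_side u hu

/-- **KERNEL GLUE: the SO(even) law with support `v ≥ 1 + 2d₁` gives DOOR_W on `(d₀, d₁)`, `d₀ > 0`,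
at every contraction `θ ≥ 0`.** For a window profile `g`, the complexified profile is an admissible test
profile of `EvenDensitySOEven k v` (smooth, real, even, `supp ⊆ [−v, v]`), its SO(even) prediction is
`0` (`soEvenLimit_windowProfile`), so `‖D⁺(g; q)‖ → 0` along the primes and is eventually
`≤ θ'·m(g)` for every `θ' > θ ≥ 0` (if `m(g) = 0` the profile is `0` and so is `D⁺`). PROVED; nothing
about `L`-functions is asserted — the SO(even) law is the HYPOTHESIS. [cite: IwaniecLuoSarnak2000, Thm. 1.1] -/
theorem signedWindowMassDoor_of_evenDensitySOEven {k : ℤ} {v d₀ d₁ θ : ℝ} (hd₀ : 0 < d₀)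
    (hv : 1 + 2 * d₁ ≤ v) (hθ : 0 ≤ θ) (hlaw : OneLevelDensityCusp.EvenDensitySOEven k v) :
    SignedWindowMassDoor k d₀ d₁ θ := by
  intro g hg θ' hθ'
  have hg' := hg
  obtain ⟨hsmooth, heven, hnonneg, hsupp⟩ := hg'
  -- the complexified profile is admissible
  set G : ℝ → ℂ := fun u ↦ (g u : ℂ) with hGdef
  have hGsmooth : ContDiff ℝ (⊤ : ℕ∞) G := Complex.ofRealCLM.contDiff.comp hsmooth
  have hGim : ∀ u, (G u).im = 0 := fun u ↦ by simp [hGdef]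
  have hGeven : ∀ u, G (-u) = G u := fun u ↦ by simp [hGdef, heven u]
  have hsuppG : Function.support G = Function.support g := by
    ext u; simp [hGdef, Function.mem_support]
  have hGsupp : tsupport G ⊆ Set.Icc (-v) v := by
    intro u hu
    have hu' : u ∈ tsupport g := by
      rw [tsupport, ← hsuppG]; exact hu
    have h := (hsupp hu').2
    rw [abs_le] at h
    rw [Set.mem_Icc]
    constructor <;> linarith
  have hlim := hlaw G hGsmooth hGim hGeven hGsupp
  rw [soEvenLimit_windowProfile hd₀ hg] at hlim
  -- ‖D⁺(g;q)‖ → 0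
  have hnorm : Tendsto (fun q : {q : ℕ // q.Prime} ↦
      haveI : NeZero (q : ℕ) := ⟨q.2.ne_zero⟩
      ‖OneLevelDensityCusp.evenDensity (q : ℕ) k G‖) atTop (nhds 0) := by
    have := hlim.norm
    simpa using this
  by_cases hm : windowMass g = 0
  · -- degenerate profile: g = 0, D⁺ = 0
    have hg0 : g = 0 := windowProfile_eq_zero_of_windowMass_eq_zero hd₀ hg hm
    refine Eventually.of_forall fun q ↦ ?_
    have hG0 : G = fun _ ↦ (0 : ℂ) := by funext u; simp [hGdef, hg0]
    rw [hG0, evenDensity_zero, norm_zero, hm, mul_zero]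
  · -- m(g) > 0: eventually ‖D⁺‖ < θ' m(g)
    have hmpos : 0 < windowMass g := by
      have hnn : 0 ≤ windowMass g := setIntegral_nonneg measurableSet_Ioi fun u _ ↦ hnonneg u
      exact lt_of_le_of_ne hnn (Ne.symm hm)
    have hε : 0 < θ' * windowMass g := mul_pos (lt_of_le_of_lt hθ hθ') hmpos
    have hev := (tendsto_order.mp hnorm).2 (θ' * windowMass g) hε
    exact hev.mono fun q hq ↦ hq.le

/-- **The window-mass bridge implies the direct density door** (K-I3-10 ⇒ K-I3-9 (5), as hypothesis
families): given `WindowMassDoorBridge k A` and the SO(even) law at some support `v > 1`, take the window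
`d₀ = (v−1)/4 < d₁ = (v−1)/2` and `θ = 0 < 1`; DOOR_W holds there by
`signedWindowMassDoor_of_evenDensitySOEven`, so the bridge yields `LOneLowerBound A`. PROVED bookkeeping;
neither door is asserted. [cite: IwaniecLuoSarnak2000, remark (B) p. 4] -/
theorem soEvenBeyondOneDoor_of_windowMassDoorBridge {k : ℤ} {A : ℕ}
    (hB : WindowMassDoorBridge k A) : SOEvenBeyondOneDoor k A := by
  rintro ⟨v, hv1, hlaw⟩
  have hd₀ : 0 < (v - 1) / 4 := by linarith
  have hd₀₁ : (v - 1) / 4 < (v - 1) / 2 := by linarith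
  have hvd : 1 + 2 * ((v - 1) / 2) ≤ v := by linarith
  exact hB ⟨(v - 1) / 4, (v - 1) / 2, 0, hd₀, hd₀₁, zero_lt_one,
    signedWindowMassDoor_of_evenDensitySOEven hd₀ hvd le_rfl hlaw⟩

end Summit.Parity.GeneralizedHardyLittlewood.Theorems.PrimeLevelFamEdgeIdeaDeltas
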